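import Summits.BirchSwinnertonDyer.BirchSwinnertonDyer.Theorems.BiquadraticEisensteinDescentKatzWaldspurgerFrameCMInertBadFromPrint
import Summits.BirchSwinnertonDyer.BirchSwinnertonDyer.Theorems.BiquadraticEisensteinDescentKatzWaldspurgerFrameCMInertBadFlatLZZRoad
import Summits.BirchSwinnertonDyer.BirchSwinnertonDyer.Theorems.BiquadraticEisensteinDescentKatzWaldspurgerFrameCMInertBadFlatZeroRigidity
import Summits.BirchSwinnertonDyer.Rank1Residual.X11b.RouteR1LogOmega
import Summits.BirchSwinnertonDyer.Rank1Residual.Partition.AnticyclotomicControlJSWEmbAt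
import Literature.NumberTheory.EllipticCurves.ComplexMultiplicationNotSemistable
import Literature.NumberTheory.EllipticCurves.ManinConstantQuadraticTwistClassCertificate
import Literature.NumberTheory.EllipticCurves.BSDQuadraticDescentArchimedeanProofs
import HarnessLib

/-!
# Route `BiquadraticEisensteinDescent` (W-ALL row 12 · K12i), crux (W♭) — the SAME theorem as
# `…Theorems.katzWaldspurgerFrameCMInertBadFlat_of_lzz` (p521367) with its statement SPELLED OUT (no reference to the
# route decl `KatzWaldspurgerFrameCMInertBadFlat`), in the binder order of the tenure planner's rev-9 decl
# `KatzWaldspurgerFrameCMInertBadFlatOfLZZ := Hsieh → LZZ-additive → <W♭ body verbatim>`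

Prover seat bsd-wall-bed-p2 (g2), 2026-08-27. HONEST FRAMING: THEOREMS ONLY (0 definitions, 0 named facts, 0 sorry);
CONDITIONAL on the two refereed named facts exactly as p521367 (Hsieh 2014 Thm A any level; LZZ 2018 §1.5 at `p² ∣ N`,
p518041). WHY A SECOND FILE: p521367 states its theorem THROUGH the rev-8 decl name `KatzWaldspurgerFrameCMInertBadFlat`;
a route edit that retires that decl (as rev 8 did to the rev-6/7 names — ops-buildfix NOTE G26-N2) would leave that file
red. This file does NOT mention any `Theses.…` decl: `w9` is the rev-8 body of W♭ typed verbatim with the LZZ input as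
second antecedent, so the rev-9 item closes by `exact …KatzWaldspurgerFrameCMInertBadFlatBody.w9` whatever the route
file renders. The proof is p521367's, verbatim (frame from `…FromPrint.exists_frameInt_of_thmA_anyLevel`; exact display
`…LZZRoad.exists_exactDisplay_of_thm151_thm153_additive`; X11b one-sided rigidity at `c ≠ 0`; `…ZeroRigidity` at `c = 0`).
References: [LiuZhangZhang2018] Duke Math. J. 167 (2018) Thm 1.5.1, Thm 1.5.3; [Hsieh2014] Doc. Math. 19 (2014) Thm A;
[Castella2018] Thms. 3.1–3.2.
-/

set_option autoImplicit false

-- D-0017 layout: summit = sub-problem, so `Summit.BirchSwinnertonDyer.BirchSwinnertonDyer.…` is the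
-- mandated namespace of Theorems files (same option as the route's sibling Theorems files).
set_option linter.dupNamespace false

noncomputable section

open scoped Classical Topology NumberField

namespace Summit.BirchSwinnertonDyer.BirchSwinnertonDyer.Theorems.KatzWaldspurgerFrameCMInertBadFlatBody

open Filter WeierstrassCurve NumberField IsDedekindDomain Field PowerSeries
  Literature.NumberTheory.EllipticCurves Literature.NumberTheory.EllipticCurves.ModularForms
  Literature.NumberTheory.EllipticCurves.Rank1Residual Literature.NumberTheory.EllipticCurves.LiuZhangZhang2018
  Literature.NumberTheory.GaloisRepresentations
  Summit.BirchSwinnertonDyer.Rank1Residual Summit.BirchSwinnertonDyer.Rank1Residual.X11b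
  Summit.BirchSwinnertonDyer.Rank1Residual.X11b.Halves
  BiquadraticEisensteinDescentKatzWaldspurgerFrameCMInertBadFlatLZZRoad
  BiquadraticEisensteinDescentKatzWaldspurgerFrameCMInertBadFlatZeroRigidity

/-- **The per-datum conclusion of (W♭), granted the Hsieh and LZZ inputs**: for `p ≥ 5` bad for `W` with
`p² ∣ N_W`, `K` imaginary quadratic Heegner field with `d_K < −4`, a Heegner datum `(Dt, H, ι_K, P)` at level `N_W`
with `p ∤ c(Dt)`, `(κ, γ)` anticyclotomic and a degree-one prime `𝔭 ∋ p`: there is a ♭-frame `(f, ι′, Ω_K, Ω_p, Q)`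
(`…FromPrint.exists_frameInt_of_thmA_anyLevel`, Hsieh input) whose value at `𝟙` is `u·(log_{ω_E} P)²` with
`‖u‖ ≤ 1` — for `P` of infinite order by X11b one-sided rigidity (`c ≠ 0`), for torsion `P` by the `c = 0` rigidity.
(Same mathematics as p521367's pointwise theorem, packaged with the frame; no `Theses.…` decl is mentioned.)
CONDITIONAL on the two named facts `hA`, `hL`. [cite: LiuZhangZhang2018, Thm 1.5.1 and Thm 1.5.3 (Duke Math. J. 167 pp. 748–749)]
[cite: Hsieh2014, Thm. A p. 712 (Doc. Math. 19) = Thm. 1 (arXiv:1112.1580 pp. 3–4)] -/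
theorem frame_value_of_lzz {p : ℕ} [Fact p.Prime]
    (hA : Hsieh2014.thmA_exists_isHsiehLFunction_unrPeriod_anyLevel)
    (hL : thm151_thm153_modularCurve_heegnerVector_additive)
    (W : WeierstrassCurve ℚ) [W.IsElliptic] [W.IsGloballyMinimal] [NeZero (W.conductorNorm ℤ)]
    (K : Type) [Field K] [NumberField K] (𝔭 : HeightOneSpectrum (𝓞 K))
    (κ : ZpExtension K p) (γ : absoluteGaloisGroup K) [Fact (κ.IsTopGenerator γ)]
    (Dt : ModularParametrizationData W (W.conductorNorm ℤ))
    (H : HeegnerDatum (W.conductorNorm ℤ) (NumberField.discr K))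
    (ιK : K →+* ℂ) (P : (W.baseChange K).toAffine.Point)
    (hp5 : 5 ≤ p) (hbad : ¬ Good W p) (hp2N : p ^ 2 ∣ W.conductorNorm ℤ) (hK : IsImaginaryQuadratic K)
    (hd4 : NumberField.discr K < -4) (hsplit : ((Ideal.span {(p : ℤ)}).primesOver (𝓞 K)).ncard = 2)
    (h𝔭 : ((p : ℕ) : 𝓞 K) ∈ 𝔭.asIdeal) (he : 𝔭.asIdeal.ramificationIdx (𝓞 ℚ) = 1)
    (hf : 𝔭.asIdeal.inertiaDeg (𝓞 ℚ) = 1)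
    (hHN : SatisfiesHeegnerHypothesis (W.conductorNorm ℤ) K) (hκ : κ.IsAnticyclotomic)
    (hcM : ¬ (p : ℤ) ∣ Dt.c)
    (hP : WeierstrassCurve.Affine.Point.map ιK.toRatAlgHom P = heegnerPointComplex Dt H) :
    ∃ (f : CuspForm (CongruenceSubgroup.Gamma0 (W.conductorNorm ℤ)) 2), IsNewformOf W f ∧
      ∃ ι' : PadicAlgCl p ≃+* ℂ,
        (∀ (w : InfinitePlace K) (k : 𝓞 K), k ∈ 𝔭.asIdeal ↔ ‖ι'.symm (w.embedding (k : K))‖ < 1) ∧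
        ∃ (ΩK : ℂ) (Ωp : (unrIntegers p)ˣ) (Q : PowerSeries (PadicComplexInt p)), ΩK ≠ 0 ∧
          R1.IsBDPLFunctionInt p ι' 𝔭 κ γ f ΩK ((Ωp : unrIntegers p) : ℂ_[p]) Q ∧
          ∃ u : ℂ_[p], ‖u‖ ≤ 1 ∧ IntSeries.HasValueAt Q 0
            (u * (algebraMap ℚ_[p] ℂ_[p] (logOmega W p (embAt K p 𝔭 h𝔭 he hf) P)) ^ 2) := by
  have hp2 : p ≠ 2 := by omega
  have hγ : κ.IsTopGenerator γ := Fact.out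
  -- the ♭-frame from the Hsieh input (bed-p2 g0, p508877)
  obtain ⟨f, hfW, ι', hι, ΩK, Ωp', Q, hΩK, hQ⟩ :=
    BiquadraticEisensteinDescentKatzWaldspurgerFrameCMInertBadFromPrint.exists_frameInt_of_thmA_anyLevel hA W p K Dt
      hp5 hbad hK hHN κ hκ γ 𝔭 h𝔭
  have hΩp : ((Ωp' : unrIntegers p) : ℂ_[p]) ≠ 0 := fun h0 ↦ by
    have h1 := norm_coe_units_unrIntegers p Ωp'
    rw [h0, norm_zero] at h1
    exact zero_ne_one h1
  set Ωp : ℂ_[p] := ((Ωp' : unrIntegers p) : ℂ_[p]) with hΩpdef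
  refine ⟨f, hfW, ι', hι, ΩK, Ωp', Q, hΩK, hQ, ?_⟩
  have hN : W.conductorNorm ℤ = W.conductorNorm ℤ := rfl
  suffices hmain : ∃ u : ℂ_[p], ‖u‖ = 1 ∧ IntSeries.HasValueAt Q 0
      (u * (algebraMap ℚ_[p] ℂ_[p] (logOmega W p (embAt K p 𝔭 h𝔭 he hf) P)) ^ 2) by
    obtain ⟨u, hu, hv⟩ := hmain
    exact ⟨u, hu.le, hv⟩
  set e : K →+* ℚ_[p] := embAt K p 𝔭 h𝔭 he hf with hedef
  have hemb : ∀ k : 𝓞 K, k ∈ 𝔭.asIdeal ↔ ‖e (k : K)‖ < 1 := mem_asIdeal_iff_norm_embAt_lt_one 𝔭 h𝔭 he hf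
  -- the exact display (LZZ road) at the embedding of the frame's prime
  obtain ⟨Ωp₀, a, C, u, σ𝔭, hΩp₀, hrad, hC, hu, hval, hdisp⟩ :=
    exists_exactDisplay_of_thm151_thm153_additive hL ι' W K 𝔭 κ γ Dt H ιK e P f hp2 hN hp2N hK hd4 hsplit h𝔭
      hι hHN hκ hγ hfW hcM hP hemb
  have hlog : Castella2018.padicLogOmega W p e P = logOmega W p e P := (R1.logOmega_eq_padicLogOmega W p e P).symm
  rw [hlog] at hval
  refine ⟨u, hu, ?_⟩
  by_cases htor : IsOfFinAddOrder P
  · -- torsion: `log P = 0`, `𝓛(𝟙) = a 0 = 0`, hence `[T⁰]Q = 0`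
    have hlog0 : logOmega W p e P = 0 := (R1.logOmega_eq_zero_iff W p e P).mpr htor
    have ha0 : a 0 = 0 := by
      rw [hlog0, map_zero, zero_pow two_ne_zero, mul_zero] at hval
      rcases mul_eq_zero.mp hval with h | h
      · exact h
      · exact absurd h (inv_ne_zero hC)
    have hQ0 : constantCoeff Q = 0 :=
      intSeries_constantCoeff_eq_zero_of_isBDPLFunctionInt_of_exactDisplay hp2 hK hκ hγ one_ne_zero hΩK hΩp₀
        hrad ha0 hC hdisp hQ
    have h := R1.intSeries_hasValueAt_zero p Q
    rw [hQ0] at h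
    rw [hlog0, map_zero, zero_pow two_ne_zero, mul_zero]
    simpa using h
  · -- infinite order: the continuous display tends to `c = u·(log P)² ≠ 0`; one-sided rigidity
    have hlogne : logOmega W p e P ≠ 0 := R1.logOmega_ne_zero W p e htor
    have hu0 : u ≠ 0 := fun h0 ↦ by rw [h0, norm_zero] at hu; exact zero_ne_one hu
    have hc0 : u * (algebraMap ℚ_[p] ℂ_[p] (logOmega W p e P)) ^ 2 ≠ 0 :=
      mul_ne_zero hu0 (pow_ne_zero _ ((map_ne_zero _).mpr hlogne))
    -- the continuous display from the exact one (same `u`)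
    have hcont : ∀ (φ : ℕ → HeckeCharacter K) (n : ℕ → ℕ) (r : ℕ → FramedGaloisRep K (PadicAlgCl p) 1),
        (∀ k, 0 < n k) → (∀ k (v : HeightOneSpectrum (𝓞 K)), (φ k).IsUnramifiedAt v) →
        (∀ k, (φ k).HasInfinityType (fun _ ↦ (n k : ℤ)) (fun _ ↦ -(n k : ℤ))) →
        (∀ k, IsPAdicAvatarOf ι' (φ k) (r k)) → (∀ k, FactorsThroughZp κ (r k)) →
        Tendsto (fun k ↦ avatarValueAt (r k) γ) atTop (𝓝 1) →
        Tendsto (fun k ↦ ((ι'.symm (bdpInterpolationValue p f 𝔭 (φ k) (n k) 1) :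
          PadicAlgCl p) : ℂ_[p]) * Ωp₀ ^ (4 * n k)) atTop
          (𝓝 (u * (algebraMap ℚ_[p] ℂ_[p] (logOmega W p e P)) ^ 2)) := by
      intro φ n r hn hunr hinf havt hfac hlimγ
      choose L hLs hdL using fun k ↦ hdisp (φ k) (n k) (r k) (hn k) (hunr k) (hinf k) (havt k) (hfac k)
      have hσ : Tendsto (fun k ↦ avatarValueAt (r k) σ𝔭) atTop (𝓝 1) := by
        rw [Metric.tendsto_nhds]
        intro ε hε
        filter_upwards [X2.PNewDisplay.eventually_forall_norm_avatarValueAt_sub_one_lt hγ hfac hlimγ hε]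
          with k hk
        rw [dist_eq_norm]
        exact hk σ𝔭
      obtain ⟨B, hB⟩ := hrad (1 / 2) (by norm_num) (by norm_num)
      have hx : Tendsto (fun k ↦ avatarValueAt (r k) γ - 1) atTop (𝓝 0) := by
        have h := hlimγ.sub_const 1
        rwa [sub_self] at h
      have hlimL : Tendsto L atTop (𝓝 (a 0)) :=
        X2.tendsto_value_of_tendsto_zero_of_coeff_bound (ρ := 1 / 2) (by norm_num) hB hx hLs
      have hlim : Tendsto (fun k ↦ L k * C⁻¹ * (avatarValueAt (r k) σ𝔭 ^ ((W.conductorNorm ℤ).factorization p))⁻¹) atTop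
          (𝓝 (a 0 * C⁻¹ * ((1 : ℂ_[p]) ^ ((W.conductorNorm ℤ).factorization p))⁻¹)) :=
        (hlimL.mul tendsto_const_nhds).mul (((hσ.pow _).inv₀ (by simp)))
      rw [show (fun k ↦ ((ι'.symm (bdpInterpolationValue p f 𝔭 (φ k) (n k) 1) : PadicAlgCl p) : ℂ_[p]) *
          Ωp₀ ^ (4 * n k)) = (fun k ↦ L k * C⁻¹ * (avatarValueAt (r k) σ𝔭 ^ ((W.conductorNorm ℤ).factorization p))⁻¹) from
        funext hdL]
      simpa only [one_pow, inv_one, mul_one, hval] using hlim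
    have heq := intSeries_constantCoeff_eq_of_isBDPLFunctionInt_of_continuousValues hp2 hK hκ hγ one_ne_zero
      hΩK hΩp₀ hΩp hcont hc0 hQ
    rw [← heq]
    exact R1.intSeries_hasValueAt_zero p Q

/-- **(W♭) with its body SPELLED OUT, in rev-9 binder order: `Hsieh any-level → LZZ additive → <W♭ body>`.** At
every datum of the crux the ♭-frame of `…FromPrint.exists_frameInt_of_thmA_anyLevel` has value `u·(log_{ω_E} P)²` at
`𝟙` with `‖u‖ ≤ 1` (`frame_value_of_lzz`). Same content and proof as p521367's `katzWaldspurgerFrameCMInertBadFlat_of_lzz`;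
no `Theses.…` decl is mentioned. CONDITIONAL on the two refereed named facts (both are antecedents here).
[cite: LiuZhangZhang2018, Thm 1.5.1 and Thm 1.5.3 (Duke Math. J. 167 pp. 748–749)]
[cite: Hsieh2014, Thm. A p. 712 (Doc. Math. 19) = Thm. 1 (arXiv:1112.1580 pp. 3–4)] -/
theorem w9 :
    Literature.NumberTheory.EllipticCurves.Hsieh2014.thmA_exists_isHsiehLFunction_unrPeriod_anyLevel →
      Literature.NumberTheory.EllipticCurves.LiuZhangZhang2018.thm151_thm153_modularCurve_heegnerVector_additive
      →
      ∀ (W : WeierstrassCurve ℚ) [W.IsElliptic] [W.IsGloballyMinimal] (p : ℕ) [Fact p.Prime] [NeZero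
      (W.conductorNorm ℤ)] (K : Type) [Field K] [NumberField K] (Dt :
      Literature.NumberTheory.EllipticCurves.ModularForms.ModularParametrizationData W (W.conductorNorm ℤ)) (H :
      Literature.NumberTheory.EllipticCurves.HeegnerDatum (W.conductorNorm ℤ) (NumberField.discr K)) (ι : K →+*
      ℂ) (P : (W.baseChange K).toAffine.Point), W.HasCM → W.analyticRank = 1 → 5 ≤ p →
      Literature.NumberTheory.EllipticCurves.Rank1Residual.CMInert W p → ¬
      Literature.NumberTheory.EllipticCurves.Rank1Residual.Good W p →
      Literature.NumberTheory.EllipticCurves.IsImaginaryQuadratic K →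
      Literature.NumberTheory.EllipticCurves.SatisfiesHeegnerHypothesis (W.conductorNorm ℤ) K → 4 <
      (NumberField.discr K).natAbs → (∀ (L : Type) [Field L] [NumberField L], Module.finrank ℚ L = 4 → (∃ x : L,
      x ^ 2 = ((Literature.NumberTheory.EllipticCurves.Rank1Residual.cmFieldDiscrOfJ W.j : ℤ) : L)) → (∃ y : L,
      y ^ 2 = ((NumberField.discr K : ℤ) : L)) → ¬ p ∣ NumberField.classNumber L) →
      WeierstrassCurve.Affine.Point.map ι.toRatAlgHom P =
      Literature.NumberTheory.EllipticCurves.ModularForms.heegnerPointComplex Dt H → ¬ (p : ℤ) ∣ Dt.c →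
      (W.quadraticTwist (NumberField.discr K : ℚ)).entireLFunction 1 ≠ 0 → ∀ (κ :
      Literature.NumberTheory.EllipticCurves.ZpExtension K p), κ.IsAnticyclotomic → ∀ (γ :
      Field.absoluteGaloisGroup K) [Fact (κ.IsTopGenerator γ)] (𝔭 : IsDedekindDomain.HeightOneSpectrum
      (NumberField.RingOfIntegers K)) (h𝔭 : ((p : ℕ) : NumberField.RingOfIntegers K) ∈ 𝔭.asIdeal) (he :
      𝔭.asIdeal.ramificationIdx (NumberField.RingOfIntegers ℚ) = 1) (hf : 𝔭.asIdeal.inertiaDeg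
      (NumberField.RingOfIntegers ℚ) = 1), ∃ (f : CuspForm (CongruenceSubgroup.Gamma0 (W.conductorNorm ℤ)) 2),
      Literature.NumberTheory.EllipticCurves.ModularForms.IsNewformOf W f ∧ ∃ ι' : PadicAlgCl p ≃+* ℂ, (∀ (w :
      NumberField.InfinitePlace K) (k : NumberField.RingOfIntegers K), k ∈ 𝔭.asIdeal ↔ ‖ι'.symm (w.embedding (k
      : K))‖ < 1) ∧ ∃ (ΩK : ℂ) (Ωp : (Literature.NumberTheory.EllipticCurves.unrIntegers p)ˣ) (Q : PowerSeries
      (PadicComplexInt p)), ΩK ≠ 0 ∧ Summit.BirchSwinnertonDyer.Rank1Residual.X11b.R1.IsBDPLFunctionInt p ι' 𝔭 κ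
      γ f ΩK ((Ωp : Literature.NumberTheory.EllipticCurves.unrIntegers p) : (PadicComplex p)) Q ∧ ∃ u :
      PadicComplex p, ‖u‖ ≤ 1 ∧ Literature.NumberTheory.EllipticCurves.IntSeries.HasValueAt Q 0 (u * (algebraMap
      (Padic p) (PadicComplex p) (Summit.BirchSwinnertonDyer.Rank1Residual.X11b.Halves.logOmega W p
      (Summit.BirchSwinnertonDyer.Rank1Residual.X11b.embAt K p 𝔭 h𝔭 he hf) P)) ^ 2) := by
  intro hA hL W _ _ p _ _ K _ _ Dt H ι P hCM _ hp5 _ hbad hK hHN hd4 _ hP hcM _ κ hκ γ hγ 𝔭 h𝔭 he hf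
  have hp : p.Prime := Fact.out
  have hpN : p ∣ W.conductorNorm ℤ := (W.dvd_conductorNorm_iff_not_hasGoodReductionAtPrime p).mpr hbad
  -- CM + bad ⟹ additive: `p² ∣ N`
  have hp2N : p ^ 2 ∣ W.conductorNorm ℤ := by
    by_contra h
    rcases hasGoodReductionAtPrime_or_hasMultiplicativeReductionAtPrime_of_not_sq_dvd_conductorNorm (V := W) h
      with hg | hm
    · exact hbad hg
    · exact not_mult_of_hasCM W hCM p hm
  have hsplit : ((Ideal.span {(p : ℤ)}).primesOver (𝓞 K)).ncard = 2 := hHN p hp hpN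
  -- `d_K′ < −4`
  have hd4' : NumberField.discr K < -4 := by
    have hneg : NumberField.discr K < 0 := by
      haveI : IsTotallyComplex K := hK.2
      exact discr_neg_of_finrank_eq_two K hK.1
    have habs : ((NumberField.discr K).natAbs : ℤ) = -NumberField.discr K := Int.ofNat_natAbs_of_nonpos hneg.le
    have : (4 : ℤ) < ((NumberField.discr K).natAbs : ℤ) := by exact_mod_cast hd4
    omega
  exact frame_value_of_lzz hA hL W K 𝔭 κ γ Dt H ι P hp5 hbad hp2N hK hd4' hsplit h𝔭 he hf hHN hκ hcM hP

end Summit.BirchSwinnertonDyer.BirchSwinnertonDyer.Theorems.KatzWaldspurgerFrameCMInertBadFlatBody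

end
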